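import Literature.NumberTheory.EllipticCurves.GaloisAction
import Literature.NumberTheory.GaloisRepresentations.AbsGaloisGroup
import Mathlib.FieldTheory.Galois.Infinite
import HarnessLib

/-!
# X11b at `p = 3` (team N8/O2), JET3-KUMMER plumbing: Galois descent of geometric points to an
# intermediate field `L ⊂ F̄` (`E(F̄)^{Gal(F̄/L)} = E(L)`, equivariantly)

HONEST FRAMING (cell `b2b-bsdres`, run/shared/lean/b2b/bsd-rank1-residual/, verbatim in every
file): the goal of the cell is to DELETE the COMBINATION-SHAPED residual classes of the
Birch–Swinnerton-Dyer formula for ALL analytic-rank `≤ 1` elliptic curves over `ℚ` — "full BSD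
formula for every rank `≤ 1` curve in class `C`" assembled STRICTLY from published theorems — so
that the rank-`≤ 1` remainder becomes exactly the CONSTRUCTION-SHAPED classes, which are TYPED
(missing-input `Prop`s), NOT attempted. This is not "finishing BSD". Team N8/O2 = `x11b3`, seat
`b2b-bsdres-x11b3-p1`, LEAD DEAL #6 A6.2 (3): "the descent plumbing [E(K̄_v)^{Γ_L} ↔ ((W⁄F)⁄L)(L)]
rides inside [the end form] or as a ≤ 80-line helper, your call" — this is the helper. THEOREMS
ONLY: no definition, no named fact, no `sorry`; nothing is booked; the flag `JET@p|N` is NOT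
discharged here.

## What

For a curve `V` over a field `F` (in the JET3-KUMMER chain: `V = W⁄K_v`), `F̄ = AlgebraicClosure F`,
the `F̄`-points `(V⁄F̄)(F̄)` with the coordinatewise action of `Aut_F(F̄)` (tree instance
`instDistribMulActionAlgEquivPoint`; this is the `Γ_F`-module `E(F̄) = geomPoints V` —
`geomPoints_smul_eq`), an intermediate field `L` of `F̄/F`, normal over `F` (in the chain:
`L = K[c]_w`), and the coordinate map `ι_L : (V⁄L)(L) → (V⁄F̄)(F̄)` (`Affine.Point.map` of
`L → F̄`, written out in each statement — no definition is introduced):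

* `map_intermediate_injective` — `ι_L` is injective;
* `smul_map_intermediate` — **equivariance**: `σ • ι_L P = ι_L (σ|_L • P)` for `σ ∈ Aut_F(F̄)`,
  `σ|_L = σ.restrictNormal L ∈ Gal(L/F)` acting on `(V⁄L)(L)` coordinatewise;
* `exists_map_intermediate_eq_of_forall_smul_eq` — **descent** (`F` perfect): an `F̄`-point fixed
  by `Gal(F̄/L) = L.fixingSubgroup` is `ι_L P` for a (unique) `P ∈ (V⁄L)(L)` (its coordinates lie in
  the fixed field of `L.fixingSubgroup`, which is `L`: Mathlib `InfiniteGalois.fixedField_fixingSubgroup`);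
* `smul_map_sub_map_eq_map_iff` — reading `σ • ι_L U − ι_L U = ι_L R` as `σ|_L • U − U = R` in
  `(V⁄L)(L)`; `forall_gal_of_forall_restrictNormal` — every element of `Gal(L/F)` is some `σ|_L`;
* `geomPoints_smul_eq` — the `Γ_F`-action on `geomPoints V` IS this action (definitional bridge to
  the currency of `Three/KolyvaginCocycleRoot.lean`, via the tree's `baseChangeGeomPointsEquiv` for
  `localPoints`).

Use (chain file 8 → files 1/4/5): the point `U ∈ E(K̄_v)` of `Three/KolyvaginCocycleRoot.lean`
(p254039; fixed by the stabiliser of `P_n`, in particular by `Gal(K̄_v/K[c]_w)`) descends to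
`U_L ∈ ((W⁄K_v)⁄L)(L)` — the currency of `JetchevKummerAtP` / `JetchevKummerLinkGlobal`.
Silverman, *AEC*, I.§1 and VIII.§1 (`E(K̄)^{G_{K̄/L}} = E(L)`). References (locators only):
[cite: SilvermanAEC2009, I.§1, VIII.§1] [cite: Jetchev2008, Prop. 4.1 proof (pp. 819–821)].
-/

noncomputable section

open scoped Classical

namespace Summit.BirchSwinnertonDyer.Rank1Residual.X11b.Three.JetchevKummer

open WeierstrassCurve Field

universe u

variable {F : Type u} [Field F] (V : WeierstrassCurve F)
  (L : IntermediateField F (AlgebraicClosure F))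

/-- `ι_L : (V⁄L)(L) → (V⁄F̄)(F̄)` is injective (coordinates). Silverman, *AEC*, I.§1. [folklore] -/
theorem map_intermediate_injective :
    Function.Injective (Affine.Point.map (W' := V.toAffine)
      (IsScalarTower.toAlgHom F L (AlgebraicClosure F))) :=
  Affine.Point.map_injective (W' := V.toAffine) _

/-- **Equivariance of `ι_L`**: `σ • ι_L P = ι_L (σ|_L • P)` for `σ ∈ Aut_F(F̄)`, where
`σ|_L = σ.restrictNormal L ∈ Gal(L/F)`, both actions coordinatewise (tree
`instDistribMulActionAlgEquivPoint`; Mathlib `AlgEquiv.restrictNormal_commutes`).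
Silverman, *AEC*, VIII.§1. [folklore] -/
theorem smul_map_intermediate [Normal F L] (σ : AlgebraicClosure F ≃ₐ[F] AlgebraicClosure F)
    (P : (V.baseChange L).toAffine.Point) :
    σ • Affine.Point.map (W' := V.toAffine) (IsScalarTower.toAlgHom F L (AlgebraicClosure F)) P =
      Affine.Point.map (W' := V.toAffine) (IsScalarTower.toAlgHom F L (AlgebraicClosure F))
        ((σ.restrictNormal L) • P) := by
  -- coordinatewise (the two `Point.map`s may carry different `DecidableEq` instances, so we do
  -- not use `Point.map_map`)
  rcases P with _ | ⟨x, y, h⟩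
  · rfl
  · rw [WeierstrassCurve.smul_def, WeierstrassCurve.smul_def]
    simp only [Affine.Point.map_some, Affine.Point.some.injEq]
    exact ⟨(AlgEquiv.restrictNormal_commutes σ L x).symm,
      (AlgEquiv.restrictNormal_commutes σ L y).symm⟩

/-- **Galois descent to the intermediate field**: an `F̄`-point fixed by every element of
`Gal(F̄/L) = L.fixingSubgroup` is `ι_L P` for some `P ∈ (V⁄L)(L)` — its coordinates lie in the
fixed field of `L.fixingSubgroup`, which is `L` since `F̄/F` is Galois (`F` perfect; Mathlib
`InfiniteGalois.fixedField_fixingSubgroup`). Silverman, *AEC*, I.§1, VIII.§1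
(`E(K̄)^{G_{K̄/L}} = E(L)`). [folklore] -/
theorem exists_map_intermediate_eq_of_forall_smul_eq [PerfectField F]
    (Q : (V.baseChange (AlgebraicClosure F)).toAffine.Point)
    (hQ : ∀ σ ∈ L.fixingSubgroup, σ • Q = Q) :
    ∃ P : (V.baseChange L).toAffine.Point,
      Affine.Point.map (W' := V.toAffine) (IsScalarTower.toAlgHom F L (AlgebraicClosure F)) P
        = Q := by
  haveI : IsGalois F (AlgebraicClosure F) := {}
  rcases Q with _ | ⟨x, y, h⟩
  · exact ⟨0, rfl⟩
  · have hxy : ∀ σ : AlgebraicClosure F ≃ₐ[F] AlgebraicClosure F, σ ∈ L.fixingSubgroup →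
        σ x = x ∧ σ y = y := by
      intro σ hσ
      have hfix := hQ σ hσ
      rw [WeierstrassCurve.smul_def, Affine.Point.map_some] at hfix
      simpa only [Affine.Point.some.injEq, AlgEquiv.coe_toAlgHom] using hfix
    have hx : x ∈ L := by
      rw [← InfiniteGalois.fixedField_fixingSubgroup L, IntermediateField.mem_fixedField_iff]
      exact fun σ hσ ↦ (hxy σ hσ).1
    have hy : y ∈ L := by
      rw [← InfiniteGalois.fixedField_fixingSubgroup L, IntermediateField.mem_fixedField_iff]
      exact fun σ hσ ↦ (hxy σ hσ).2
    have h₀ : (V.baseChange L).toAffine.Nonsingular (⟨x, hx⟩ : L) ⟨y, hy⟩ :=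
      (Affine.baseChange_nonsingular V
        (IsScalarTower.toAlgHom F L (AlgebraicClosure F)).injective ⟨x, hx⟩ ⟨y, hy⟩).mp h
    exact ⟨Affine.Point.some ⟨x, hx⟩ ⟨y, hy⟩ h₀, by rw [Affine.Point.map_some]; rfl⟩

/-- **Reading an identity of `(V⁄F̄)(F̄)` in `(V⁄L)(L)`**: for `σ ∈ Aut_F(F̄)` and `L`-points
`U`, `R`: `σ • ι_L U − ι_L U = ι_L R` iff `σ|_L • U − U = R`. (Moves the cocycle identity
`(σ−1)U = R_σ` of `Three/KolyvaginCocycleRoot.lean` to the `L`-points of `JetchevKummerAtP`.)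
[folklore] -/
theorem smul_map_sub_map_eq_map_iff [Normal F L] (σ : AlgebraicClosure F ≃ₐ[F] AlgebraicClosure F)
    (U R : (V.baseChange L).toAffine.Point) :
    σ • Affine.Point.map (W' := V.toAffine) (IsScalarTower.toAlgHom F L (AlgebraicClosure F)) U -
        Affine.Point.map (W' := V.toAffine) (IsScalarTower.toAlgHom F L (AlgebraicClosure F)) U =
        Affine.Point.map (W' := V.toAffine) (IsScalarTower.toAlgHom F L (AlgebraicClosure F)) R ↔
      (σ.restrictNormal L) • U - U = R := by
  rw [smul_map_intermediate V L σ U, ← map_sub]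
  exact (map_intermediate_injective V L).eq_iff

/-- Every element of `Gal(L/F)` is a restriction `σ|_L` of some `σ ∈ Aut_F(F̄)` (Mathlib
`AlgEquiv.restrictNormalHom_surjective`), so hypotheses quantified over `Aut_F(F̄)` descend to
hypotheses quantified over `Gal(L/F)`. [folklore] -/
theorem forall_gal_of_forall_restrictNormal [Normal F L] {p : (L ≃ₐ[F] L) → Prop}
    (h : ∀ σ : AlgebraicClosure F ≃ₐ[F] AlgebraicClosure F, p (σ.restrictNormal L)) :
    ∀ τ : L ≃ₐ[F] L, p τ := by
  intro τ
  obtain ⟨σ, hσ⟩ := AlgEquiv.restrictNormalHom_surjective (F := F) (K₁ := L)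
    (AlgebraicClosure F) τ
  rw [← hσ]
  exact h σ

/-- **Bridge to `geomPoints`**: the `Γ_F`-action on `E(F̄) = geomPoints V` (tree
`geomPoints.instDistribMulActionAbsoluteGaloisGroup`) is the coordinatewise action of the
underlying `F`-automorphism (tree `absoluteGaloisGroup.toAlgEquiv`, the identity) on
`(V⁄F̄)(F̄)` — definitionally. [folklore] -/
theorem geomPoints_smul_eq (σ : absoluteGaloisGroup F) (Q : geomPoints V) :
    σ • Q = (show geomPoints V from
      (absoluteGaloisGroup.toAlgEquiv F σ) •
        (show (V.baseChange (AlgebraicClosure F)).toAffine.Point from Q)) :=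
  rfl

end Summit.BirchSwinnertonDyer.Rank1Residual.X11b.Three.JetchevKummer

end
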